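import Literature.NumberTheory.Sieve.ChenTheoremIUpperSieveTools
import Literature.NumberTheory.Sieve.ChenTheoremIAssembly
import HarnessLib

/-!
# Chen's Theorem I: the upper bound for `∑_q S(A_q, 𝒫, x^{1/10})` (Chen 1973, Lemma 9, second half)

Companion of `ChenTheoremIAssembly.lean`, which assembles Chen's Theorem I
(`P_x(1,2) ≥ 0.67 x C_x/(log x)²`, Sci. Sinica 16 (1973)) from three sieve estimates at Chen's
sieving level `z = x^{1/10}`. This file PROVES hypothesis (B) of
`Literature.NumberTheory.Sieve.Chen.Chen1973_theoremI_of`, with the constant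
`b = ∫_{1/10}^{1/3} F(5 − 10β) dβ/β` (`F = upperSieveFun 1`, the upper function of the linear sieve):

* `siftedCountDvd_tenth_sum_upper` — for every `ε > 0` and all large even `x`,
  `∑_{x^{1/10} ≤ q < x^{1/3}, q prime} S(A_q, 𝒫, x^{1/10}) ≤ (b + ε) · x V(x^{1/10})/log x`,
  `A = {x − p : p ≤ x prime, p ∤ x}`, `V(z) = ∏_{p < z, p ∤ x} (1 − 1/(p−1))`.

This is Chen's (32) (PDF p. 168 of the held copy: Richert's Theorem A with `ξ² = x^{1/2−ε}/p`, `q = p`,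
remainders by Bombieri's theorem; with `F` inserted, `b = e^γ((2/5) log 8 + (1/5)∫_3^4 10 J(u−1) du/(u(5−u)))`,
Chen's `4 log 8 + 2 I₂` in units `x C_x/(log x)²` after `× 20e^{−γ}/2`), i.e. Nathanson's Theorem 10.5
moved from `N^{1/8}` to `N^{1/10}`. Proof (Nathanson pp. 172–175): for each prime `q` of the window,
Iwaniec's linear-sieve upper bound (Thm 1, `κ = 1`, uniform in the sequence;
`Iwaniec1980_thm1_upper_of_half_lt`) for `A_q = (chenGoldbachSeq x).restrictDvd q` at level
`D/q`, `D = x^{1/2−δ}` (`s_q = 10(1/2 − δ) − 10 log q/log x`), main terms summed with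
`sum_midPrimes_upperSieveFun_div_le` (`g(q) ≤ 1/(q−1) = 1/q + O(1/q²)`, `F ≤ 2e^γ`) and
`exists_integral_upperSieveFun_shift_le` (`δ → 0`), remainders rearranged by `sum_midPrimes_sum_le`
(`r_q(d) = r(qd)`, `(q,d) ↦ qd` injective) and bounded by Bombieri–Vinogradov in `π`-form
(`eventually_sum_abs_primeCountingDisc_le`), `X = π(x) ≤ (1 + η) x/log x` (prime number theorem).

## References

* Chen Jing-run, Sci. Sinica 16 (1973) 157–176, Lemma 9, (32) (PDF p. 168 of the held copy).
  [ChenSciSinica1973]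
* M. B. Nathanson, *Additive Number Theory: The Classical Bases*, GTM 164 (1996), Thm 10.5 and its
  proof, pp. 172–175 of the held copy. [Nathanson1996]
* H. Iwaniec, *Rosser's sieve*, Acta Arith. 36 (1980), 171–202, Theorem 1. [IwaniecActaArith1980]
-/

open Finset Filter Topology

noncomputable section

namespace Literature.NumberTheory.Sieve.Chen

open SieveSequence ChenSieve

/-- The constant `b = ∫_{1/10}^{1/3} F(5 − 10β) dβ/β` is nonnegative (`F ≥ 0` on `[5/3, 4]`). [folklore] -/
theorem integral_upperSieveFun_tenth_nonneg :
    0 ≤ ∫ β in (1 / 10 : ℝ)..(1 / 3), upperSieveFun 1 (5 - 10 * β) / β := by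
  refine intervalIntegral.integral_nonneg (by norm_num) fun β hβ => ?_
  have hβ0 : 0 < β := by linarith [hβ.1]
  have hF : 0 < upperSieveFun 1 (5 - 10 * β) :=
    upperSieveFun_one_pos ⟨by linarith [hβ.2], by linarith [hβ.1]⟩
  positivity

/-- `1/(q − 1) ≤ 1/q + 2/q²` for `q ≥ 2`. [folklore] -/
theorem inv_sub_one_le_inv_add {q : ℝ} (hq : 2 ≤ q) : (q - 1)⁻¹ ≤ 1 / q + 2 * (1 / q ^ 2) := by
  have hq0 : 0 < q := by linarith
  rw [inv_eq_one_div, show 1 / q + 2 * (1 / q ^ 2) = (q + 2) / q ^ 2 by field_simp,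
    div_le_div_iff₀ (by linarith) (by positivity)]
  nlinarith

/-- `1/(q − 1) ≤ 2/q` for `q ≥ 2`. [folklore] -/
theorem inv_sub_one_le_two_div {q : ℝ} (hq : 2 ≤ q) : (q - 1)⁻¹ ≤ 2 * (1 / q) := by
  have hq0 : 0 < q := by linarith
  rw [inv_eq_one_div, mul_one_div, div_le_div_iff₀ (by linarith) hq0]
  nlinarith

set_option maxHeartbeats 1600000 in
/-- **Chen's Lemma 9, second half (hypothesis (B) of `Chen1973_theoremI_of`), PROVED**: for every
`ε > 0` and all large even `x`,
`∑_{x^{1/10} ≤ q < x^{1/3}} S(A_q, 𝒫, x^{1/10}) ≤ (b + ε) x V(x^{1/10})/log x` with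
`b = ∫_{1/10}^{1/3} F(5 − 10β) dβ/β`, `F = upperSieveFun 1`. See the module docstring for the proof.
[cite: ChenSciSinica1973, Lemma 9 (32)] -/
theorem siftedCountDvd_tenth_sum_upper {ε : ℝ} (hε : 0 < ε) :
    ∃ x₀ : ℕ, ∀ x : ℕ, x₀ ≤ x → Even x →
      ∑ q ∈ midPrimes ((x : ℝ) ^ (1 / 10 : ℝ)) (y x),
          (siftedCountDvd x q ((x : ℝ) ^ (1 / 10 : ℝ)) : ℝ) ≤
        ((∫ β in (1 / 10 : ℝ)..(1 / 3), upperSieveFun 1 (5 - 10 * β) / β) + ε) *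
          ((x : ℝ) * sieveProduct x ((x : ℝ) ^ (1 / 10 : ℝ)) / Real.log x) := by
  set b := ∫ β in (1 / 10 : ℝ)..(1 / 3), upperSieveFun 1 (5 - 10 * β) / β with hb
  have hb0 : 0 ≤ b := integral_upperSieveFun_tenth_nonneg
  set A : ℝ := 2 * Real.exp Real.eulerMascheroniConstant with hA
  have hA0 : 0 < A := by positivity
  -- the working accuracy `ε' = min ε 1`
  set ε' := min ε 1 with hε'
  have hε'0 : 0 < ε' := lt_min hε one_pos
  have hε'ε : ε' ≤ ε := min_le_left _ _
  have hε'1 : ε' ≤ 1 := min_le_right _ _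
  -- continuity of the main-term integral: `δ < ρ`
  obtain ⟨ρ, hρ0, hρ⟩ := exists_integral_upperSieveFun_shift_le (ε := ε' / 16) (by positivity)
  -- parameters: level `x^{1/2 − δ}`
  set δ := min (1 / 30) (ρ / 2) with hδ
  have hδ0 : 0 < δ := by positivity
  have hδ1 : δ ≤ 1 / 30 := min_le_left _ _
  have hδρ : δ < ρ := lt_of_le_of_lt (min_le_right _ _) (by linarith)
  set θ₁ := 1 / 2 - δ with hθ₁
  have hθ₁lt : θ₁ < 1 / 2 := by rw [hθ₁]; linarith
  have hθ₁ge : 1 / 2 - 1 / 30 ≤ θ₁ := by rw [hθ₁]; linarith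
  have hθ₁pos : 0 < θ₁ := by linarith
  have hint := hρ δ hδ0.le hδρ
  rw [show (5 : ℝ) - 10 * δ = 10 * θ₁ by rw [hθ₁]; ring] at hint
  -- i.e. `∫ F(10θ₁ − 10β)/β ≤ b + (ε'/16) log(10/3)`
  have hlog103 : Real.log ((1 / 3 : ℝ) / (1 / 10)) ≤ 2 := by
    have h1 : Real.log ((1 / 3 : ℝ) / (1 / 10)) ≤ Real.log 4 :=
      Real.log_le_log (by norm_num) (by norm_num)
    have h2 : Real.log (4 : ℝ) = 2 * Real.log 2 := by
      rw [show (4 : ℝ) = 2 ^ 2 by norm_num, Real.log_pow]; norm_num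
    have h3 := Real.log_two_lt_d9
    rw [h2] at h1
    norm_num at h3
    linarith
  have hlog103' : 0 ≤ Real.log ((1 / 3 : ℝ) / (1 / 10)) := Real.log_nonneg (by norm_num)
  -- the number of cells `K` with `A log(10/3)/K ≤ ε'/16`
  obtain ⟨K, hK0, hKε⟩ : ∃ K : ℕ, 0 < K ∧ A * 2 / K ≤ ε' / 16 := by
    refine ⟨⌈A * 2 / (ε' / 16)⌉₊ + 1, by omega, ?_⟩
    have h1 : A * 2 / (ε' / 16) ≤ ⌈A * 2 / (ε' / 16)⌉₊ := Nat.le_ceil _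
    rw [div_le_iff₀ (by positivity)] at h1
    rw [div_le_iff₀ (by positivity)]
    push_cast
    nlinarith
  -- PNT accuracy
  set η := ε' / (8 * (b + 1)) with hη
  have hη0 : 0 < η := by positivity
  -- the linear sieve (Iwaniec's Theorem 1, upper, `κ = 1`)
  obtain ⟨B, hB, hBC⟩ := Iwaniec1980_thm1_upper_of_half_lt (κ := 1) (by norm_num)
  obtain ⟨C, hC⟩ := hBC dimConst
  have hFeq : Set.EqOn B.1 (iwaniecUpperSieveFun 1) (Set.Ioi 0) := hB.eqOn_iwaniecSieveFun.1
  -- Bombieri–Vinogradov (`π`-form, level `x^{θ₁}`)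
  obtain ⟨C₁, hC₁⟩ := eventually_sum_abs_primeCountingDisc_le BombieriVinogradovStatement_holds
    hθ₁lt (A := 4) (by norm_num)
  -- the constant of `V(z)⁻¹ ≤ κ₀ log x`
  have hlog2 : 0 < Real.log 2 := Real.log_pos one_lt_two
  have hdim0 : 0 ≤ dimConst := by rw [dimConst]; positivity
  set κ₀ := (1 + dimConst / Real.log 2) / (10 * Real.log 2) with hκ₀
  have hκ₀0 : 0 < κ₀ := by positivity
  -- eventualities
  have hE1 := eventually_primeCounting_bounds hη0
  have hE2 : ∀ᶠ N : ℕ in atTop, 6 * |C| * ((θ₁ - 1 / 3) * Real.log N) ^ (-(1 / 3 : ℝ)) ≤ ε' / 16 := by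
    have hpos : 0 < θ₁ - 1 / 3 := by linarith
    have ht : Tendsto (fun x : ℝ => 6 * |C| * ((θ₁ - 1 / 3) * Real.log x) ^ (-(1 / 3 : ℝ))) atTop
        (𝓝 (6 * |C| * 0)) :=
      ((tendsto_rpow_neg_atTop (by norm_num : (0 : ℝ) < 1 / 3)).comp
        (Real.tendsto_log_atTop.const_mul_atTop hpos)).const_mul _
    rw [mul_zero] at ht
    exact tendsto_natCast_atTop_atTop.eventually (ht.eventually_le_const (by positivity))
  have hE3 : ∀ᶠ N : ℕ in atTop, 16 * κ₀ * max C₁ 0 ≤ ε' * Real.log N ^ 2 := by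
    have ht : Tendsto (fun x : ℝ => ε' * Real.log x ^ 2) atTop atTop :=
      ((tendsto_pow_atTop two_ne_zero).comp Real.tendsto_log_atTop).const_mul_atTop hε'0
    exact tendsto_natCast_atTop_atTop.eventually (ht.eventually_ge_atTop _)
  have hE4 : ∀ᶠ N : ℕ in atTop,
      Real.log (N : ℝ) ^ 3 ≤ ε' * Real.log 2 / (16 * κ₀) * (N : ℝ) ^ (1 - θ₁) := by
    have hlo := (isLittleO_log_rpow_rpow_atTop 3 (show (0 : ℝ) < 1 - θ₁ by linarith)).def
      (show 0 < ε' * Real.log 2 / (16 * κ₀) by positivity)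
    filter_upwards [tendsto_natCast_atTop_atTop.eventually hlo, eventually_ge_atTop 1] with N hN hN1
    have hN0 : (0 : ℝ) ≤ N := Nat.cast_nonneg N
    rw [Real.norm_of_nonneg (by positivity), Real.norm_of_nonneg (Real.rpow_nonneg hN0 _)] at hN
    have e3 : Real.log (N : ℝ) ^ (3 : ℝ) = Real.log N ^ 3 := by
      rw [show (3 : ℝ) = ((3 : ℕ) : ℝ) by norm_num, Real.rpow_natCast]
    rwa [e3] at hN
  have hE5 : ∀ᶠ N : ℕ in atTop, A * (40 * K / (1 / 10 * Real.log N)) ≤ ε' / 16 := by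
    have ht : Tendsto (fun x : ℝ => A * (40 * K / (1 / 10 * Real.log x))) atTop (𝓝 (A * 0)) := by
      refine Tendsto.const_mul _ ?_
      have : Tendsto (fun x : ℝ => 1 / 10 * Real.log x) atTop atTop :=
        Real.tendsto_log_atTop.const_mul_atTop (by norm_num)
      exact (tendsto_const_nhds (x := (40 * K : ℝ))).div_atTop this
    rw [mul_zero] at ht
    exact tendsto_natCast_atTop_atTop.eventually (ht.eventually_le_const (by positivity))
  have hE6 : ∀ᶠ N : ℕ in atTop, 2 * A / ((N : ℝ) ^ (1 / 10 : ℝ) - 1) ≤ ε' / 16 := by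
    have h1 : Tendsto (fun x : ℝ => x ^ (1 / 10 : ℝ) - 1) atTop atTop :=
      tendsto_atTop_add_const_right _ _ (tendsto_rpow_atTop (by norm_num))
    have ht : Tendsto (fun x : ℝ => 2 * A / (x ^ (1 / 10 : ℝ) - 1)) atTop (𝓝 0) :=
      (tendsto_const_nhds (x := 2 * A)).div_atTop h1
    exact tendsto_natCast_atTop_atTop.eventually (ht.eventually_le_const (by positivity))
  have hlogT : Tendsto (fun N : ℕ => Real.log N) atTop atTop :=
    Real.tendsto_log_atTop.comp (tendsto_natCast_atTop_atTop (R := ℝ))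
  have hE7 : ∀ᶠ N : ℕ in atTop, 400 ≤ Real.log N := hlogT.eventually_ge_atTop 400
  obtain ⟨N₀, hN₀⟩ := Filter.eventually_atTop.mp
    ((eventually_ge_atTop (3 ^ 10)).and (hE1.and (hC₁.and (hE2.and (hE3.and (hE4.and (hE5.and
      (hE6.and hE7))))))))
  refine ⟨N₀, fun N hN hEven => ?_⟩
  obtain ⟨h310, hPNT, hBVN, h2, h3, h4, h5, h6, h400L⟩ := hN₀ N hN
  -- basic facts about `N`
  have hN0 : N ≠ 0 := by omega
  have hN1 : (1 : ℝ) < N := by exact_mod_cast (show 1 < N by omega)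
  have hNpos : (0 : ℝ) < N := by linarith
  set L := Real.log N with hL
  have hL0 : 0 < L := Real.log_pos hN1
  -- the sieve parameters `z = N^{1/10}`, `y = N^{1/3}`, `D = N^{1/2 - δ}`
  set zN := (N : ℝ) ^ (1 / 10 : ℝ) with hzN
  set yN := (N : ℝ) ^ (1 / 3 : ℝ) with hyN
  have hyNdef : y N = yN := rfl
  set D := (N : ℝ) ^ θ₁ with hD
  have hz3 : 3 ≤ zN := by
    rw [hzN, show (3 : ℝ) = ((3 : ℝ) ^ (10 : ℕ)) ^ (1 / 10 : ℝ) by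
      rw [← Real.rpow_natCast, ← Real.rpow_mul (by norm_num)]; norm_num]
    exact Real.rpow_le_rpow (by norm_num) (by exact_mod_cast h310) (by norm_num)
  have hz2 : 2 ≤ zN := by linarith
  have hlogz : Real.log zN = 1 / 10 * L := by rw [hzN, Real.log_rpow hNpos]
  have hlogy : Real.log yN = 1 / 3 * L := by rw [hyN, Real.log_rpow hNpos]
  have hlogD : Real.log D = θ₁ * L := by rw [hD, Real.log_rpow hNpos]
  have hzy : zN ≤ yN := by
    rw [hzN, hyN]; exact Real.rpow_le_rpow_of_exponent_le hN1.le (by norm_num)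
  have hD0 : 0 < D := Real.rpow_pos_of_pos hNpos _
  have hzyD : zN * yN ≤ D := by
    rw [hzN, hyN, hD, ← Real.rpow_add hNpos]
    exact Real.rpow_le_rpow_of_exponent_le hN1.le (by rw [hθ₁]; linarith)
  -- the window `Q` of primes `z ≤ q < y`
  set Q := midPrimes zN yN with hQdef
  have hQmem : ∀ q ∈ Q, q.Prime ∧ zN ≤ q ∧ (q : ℝ) < yN := fun q hq => by
    rw [hQdef, midPrimes, Finset.mem_filter, Nat.mem_primesBelow] at hq
    exact ⟨hq.1.2, hq.2, Nat.lt_ceil.mp hq.1.1⟩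
  -- names
  have hdim := hasIwaniecDimension_chenGoldbachSeq hEven
  set V := sieveProduct N zN with hV
  set X := (Nat.primeCounting N : ℝ) with hX
  set M := (N : ℝ) * V / L with hM
  set ℓ := ((θ₁ - 1 / 3) * L) ^ (-(1 / 3 : ℝ)) with hℓ
  have hVI : 0 ≤ V ∧ V ≤ 1 := sieveProduct_mem_Icc hEven zN
  have hVpos : 0 < V := by
    rw [hV, ← densityProduct_chenGoldbachSeq]; exact hdim.densityProduct_pos zN
  have hVinv : V⁻¹ ≤ κ₀ * L := by
    have h := hdim.inv_densityProduct_le hz2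
    rw [densityProduct_chenGoldbachSeq, Real.rpow_one, hlogz] at h
    refine h.trans (le_of_eq ?_)
    rw [hκ₀]; field_simp
  have hX0 : 0 ≤ X := Nat.cast_nonneg _
  have hMpos : 0 < M := by positivity
  have hKM : (N : ℝ) / (κ₀ * L ^ 2) ≤ M := by
    have h1 : (κ₀ * L)⁻¹ ≤ V := by rw [inv_le_comm₀ (by positivity) hVpos]; exact hVinv
    calc (N : ℝ) / (κ₀ * L ^ 2) = (N : ℝ) / L * (κ₀ * L)⁻¹ := by field_simp
      _ ≤ (N : ℝ) / L * V := mul_le_mul_of_nonneg_left h1 (by positivity)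
      _ = M := by rw [hM]; ring
  have hℓ0 : 0 ≤ ℓ := Real.rpow_nonneg (mul_pos (by linarith) hL0).le _
  -- (1) the sieve bound for one `A_q`
  have hq_bound : ∀ q ∈ Q, (siftedCountDvd N q zN : ℝ) ≤
      ((q : ℝ) - 1)⁻¹ * (X * V * (upperSieveFun 1 (10 * θ₁ - 10 * (Real.log q / L)) + |C| * ℓ)) +
        ∑ d ∈ (Finset.range ⌈D / q⌉₊).filter (· ∣ primesProdBelow zN),
          |(chenGoldbachSeq N).remainder (q * d) N| := by
    intro q hq
    obtain ⟨hqp, hzq, hqy⟩ := hQmem q hq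
    have hq0 : (0 : ℝ) < q := by exact_mod_cast hqp.pos
    have hq2 : (2 : ℝ) ≤ q := by exact_mod_cast hqp.two_le
    have hzDq : zN ≤ D / q := by
      rw [le_div_iff₀ hq0]
      calc zN * q ≤ zN * yN := mul_le_mul_of_nonneg_left hqy.le (by linarith)
        _ ≤ D := hzyD
    have hlogq : Real.log q < 1 / 3 * L := by
      rw [← hlogy]; exact Real.log_lt_log hq0 hqy
    have hlogqz : 1 / 10 * L ≤ Real.log q := by
      rw [← hlogz]; exact Real.log_le_log (by linarith) hzq
    have hsq : Real.log (D / q) / Real.log zN = 10 * θ₁ - 10 * (Real.log q / L) := by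
      rw [Real.log_div hD0.ne' hq0.ne', hlogD, hlogz]
      field_simp
    have hql : Real.log q / L < 1 / 3 := by rw [div_lt_iff₀ hL0]; linarith
    have hqL : 1 / 10 ≤ Real.log q / L := by rw [le_div_iff₀ hL0]; linarith
    have hs0 : (0 : ℝ) < 10 * θ₁ - 10 * (Real.log q / L) := by linarith
    have hs_mem : 10 * θ₁ - 10 * (Real.log q / L) ∈ Set.Icc (1 : ℝ) 4 :=
      ⟨by linarith, by linarith⟩
    -- Iwaniec's theorem for `A_q`
    have hsize0 : 0 ≤ ((chenGoldbachSeq N).restrictDvd q).size N := by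
      rw [size_restrictDvd_chenGoldbachSeq]
      exact mul_nonneg (shiftedPrimesDensity_prime_mem_Icc' hqp).1 hX0
    have h := hC ((chenGoldbachSeq N).restrictDvd q) hdim N (D / q) zN hz2 hzDq hsize0
    rw [sifted_restrictDvd_chenGoldbachSeq, densityProduct_restrictDvd_chenGoldbachSeq,
      size_restrictDvd_chenGoldbachSeq, hsq, hFeq hs0, ← upperSieveFun_one] at h
    -- the remainder sum: `r_q(d) = r(qd)`
    have hrem : ∑ d ∈ (Finset.range ⌈D / q⌉₊).filter (· ∣ primesProdBelow zN),
        |((chenGoldbachSeq N).restrictDvd q).remainder d N| =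
        ∑ d ∈ (Finset.range ⌈D / q⌉₊).filter (· ∣ primesProdBelow zN),
          |(chenGoldbachSeq N).remainder (q * d) N| := by
      refine Finset.sum_congr rfl fun d hd => ?_
      rw [remainder_restrictDvd_chenGoldbachSeq hqp (Nat.ceil_le.mpr hzq) (Finset.mem_filter.mp hd).2]
    rw [hrem] at h
    refine h.trans (add_le_add ?_ le_rfl)
    -- the main term: `g(q) X V (F + C ℓ_q) ≤ (q-1)⁻¹ X V (F + |C| ℓ)`
    set Fq := upperSieveFun 1 (10 * θ₁ - 10 * (Real.log q / L)) with hFq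
    have hFq0 : 0 ≤ Fq := (upperSieveFun_one_pos ⟨hs0, by linarith [hs_mem.2]⟩).le
    have hℓq : C * Real.log (D / q) ^ (-(1 / 3 : ℝ)) ≤ |C| * ℓ := by
      have hlogDq : (θ₁ - 1 / 3) * L ≤ Real.log (D / q) := by
        rw [Real.log_div hD0.ne' hq0.ne', hlogD]
        have e : (θ₁ - 1 / 3) * L = θ₁ * L - 1 / 3 * L := by ring
        rw [e]; linarith
      have hpos : 0 < (θ₁ - 1 / 3) * L := mul_pos (by linarith) hL0
      have h1 : Real.log (D / q) ^ (-(1 / 3 : ℝ)) ≤ ℓ :=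
        Real.rpow_le_rpow_of_nonpos hpos hlogDq (by norm_num)
      have h0 : 0 ≤ Real.log (D / q) ^ (-(1 / 3 : ℝ)) := Real.rpow_nonneg (by linarith) _
      calc C * Real.log (D / q) ^ (-(1 / 3 : ℝ)) ≤ |C| * Real.log (D / q) ^ (-(1 / 3 : ℝ)) :=
            mul_le_mul_of_nonneg_right (le_abs_self C) h0
        _ ≤ |C| * ℓ := mul_le_mul_of_nonneg_left h1 (abs_nonneg C)
    obtain ⟨hg0, hg1⟩ := shiftedPrimesDensity_prime_mem_Icc' (N := N) hqp
    have hXV : 0 ≤ X * V := mul_nonneg hX0 hVI.1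
    have hrhs0 : 0 ≤ X * V * (Fq + |C| * ℓ) :=
      mul_nonneg hXV (add_nonneg hFq0 (mul_nonneg (abs_nonneg C) hℓ0))
    calc shiftedPrimesDensity N q * X * V * (Fq + C * Real.log (D / q) ^ (-(1 / 3 : ℝ)))
        ≤ shiftedPrimesDensity N q * X * V * (Fq + |C| * ℓ) := by
          have : 0 ≤ shiftedPrimesDensity N q * X * V := mul_nonneg (mul_nonneg hg0 hX0) hVI.1
          exact mul_le_mul_of_nonneg_left (by linarith) this
      _ = shiftedPrimesDensity N q * (X * V * (Fq + |C| * ℓ)) := by ring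
      _ ≤ ((q : ℝ) - 1)⁻¹ * (X * V * (Fq + |C| * ℓ)) :=
          mul_le_mul_of_nonneg_right hg1 hrhs0
  -- (2) sum over `q`: the remainders
  have hRsum : ∑ q ∈ Q, ∑ d ∈ (Finset.range ⌈D / q⌉₊).filter (· ∣ primesProdBelow zN),
      |(chenGoldbachSeq N).remainder (q * d) N| ≤ ε' / 8 * M := by
    have h1 := sum_midPrimes_sum_le (z := zN) (y := yN) (D := D)
      (fun m => |(chenGoldbachSeq N).remainder m N|) (fun m => abs_nonneg _)
    refine h1.trans ?_
    -- `∑_{1 ≤ m ≤ D} |r(m)| ≤ ∑_m |δ(N; m)| + D ω(N)`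
    have hω : (N.primeFactors.card : ℝ) ≤ L / Real.log 2 := card_primeFactors_le_log_div hN0
    have h2 : ∑ m ∈ Finset.Icc 1 ⌊D⌋₊, |(chenGoldbachSeq N).remainder m N| ≤
        (∑ m ∈ Finset.Icc 1 ⌊D⌋₊, |primeCountingDisc m (resUnit N m : ZMod m) N|) +
          D * N.primeFactors.card := by
      calc ∑ m ∈ Finset.Icc 1 ⌊D⌋₊, |(chenGoldbachSeq N).remainder m N|
          ≤ ∑ m ∈ Finset.Icc 1 ⌊D⌋₊,
              (|primeCountingDisc m (resUnit N m : ZMod m) N| + N.primeFactors.card) :=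
            Finset.sum_le_sum fun m hm =>
              abs_remainder_chenGoldbachSeq_le hN0 (Nat.one_le_iff_ne_zero.mp (Finset.mem_Icc.mp hm).1)
        _ = (∑ m ∈ Finset.Icc 1 ⌊D⌋₊, |primeCountingDisc m (resUnit N m : ZMod m) N|) +
              ⌊D⌋₊ * N.primeFactors.card := by
            rw [Finset.sum_add_distrib, Finset.sum_const, Nat.card_Icc, Nat.add_sub_cancel, nsmul_eq_mul]
        _ ≤ _ := by gcongr; exact Nat.floor_le hD0.le
    refine h2.trans ?_
    have hb := hBVN (resUnit N)
    rw [show (4 : ℝ) = ((4 : ℕ) : ℝ) by norm_num, Real.rpow_natCast] at hb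
    have hR1 : C₁ * N / L ^ 4 ≤ ε' / 16 * M := by
      have h3' : 16 * κ₀ * max C₁ 0 ≤ ε' * L ^ 2 := h3
      calc C₁ * N / L ^ 4 ≤ max C₁ 0 * N / L ^ 4 := by
            rw [mul_div_assoc, mul_div_assoc]
            exact mul_le_mul_of_nonneg_right (le_max_left _ _) (by positivity)
        _ = (16 * κ₀ * max C₁ 0) * (N / (16 * κ₀ * L ^ 4)) := by field_simp
        _ ≤ (ε' * L ^ 2) * (N / (16 * κ₀ * L ^ 4)) := mul_le_mul_of_nonneg_right h3' (by positivity)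
        _ = ε' / 16 * (N / (κ₀ * L ^ 2)) := by field_simp
        _ ≤ ε' / 16 * M := mul_le_mul_of_nonneg_left hKM (by positivity)
    have hR2 : D * (N.primeFactors.card : ℝ) ≤ ε' / 16 * M := by
      have hsplit : (N : ℝ) = D * (N : ℝ) ^ (1 - θ₁) := by
        rw [hD, ← Real.rpow_add hNpos, show θ₁ + (1 - θ₁) = 1 by ring, Real.rpow_one]
      calc D * (N.primeFactors.card : ℝ) ≤ D * (L / Real.log 2) :=
            mul_le_mul_of_nonneg_left hω hD0.le
        _ = D * L ^ 3 / (Real.log 2 * L ^ 2) := by field_simp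
        _ ≤ D * (ε' * Real.log 2 / (16 * κ₀) * (N : ℝ) ^ (1 - θ₁)) / (Real.log 2 * L ^ 2) := by
            gcongr
        _ = ε' / 16 * ((D * (N : ℝ) ^ (1 - θ₁)) / (κ₀ * L ^ 2)) := by field_simp
        _ = ε' / 16 * (N / (κ₀ * L ^ 2)) := by rw [← hsplit]
        _ ≤ ε' / 16 * M := mul_le_mul_of_nonneg_left hKM (by positivity)
    linarith
  -- (3) sum over `q`: the main terms
  have hFsum : ∑ q ∈ Q, ((q : ℝ) - 1)⁻¹ *
      (X * V * (upperSieveFun 1 (10 * θ₁ - 10 * (Real.log q / L)) + |C| * ℓ)) ≤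
      X * V * (b + 3 * ε' / 8) := by
    -- `∑ F_q/q ≤ ∫ + A(log(10/3)/K + 400K/L)`
    have hwin := sum_midPrimes_upperSieveFun_div_le (x := (N : ℝ)) (θ := θ₁) hz3 hN1 hθ₁ge
      hθ₁lt.le hK0
    -- `∑ 1/q² ≤ 1/(⌈z⌉ - 1)` and `∑ 1/q ≤ log(10/3) + 400/L`
    have hQsub : Q ⊆ Finset.Ico ⌈zN⌉₊ ⌈yN⌉₊ := by
      rw [hQdef, midPrimes_eq_primesIco_of_level]; exact Finset.filter_subset _ _
    have hz'2 : 2 ≤ ⌈zN⌉₊ := by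
      have : (2 : ℝ) ≤ ((⌈zN⌉₊ : ℕ) : ℝ) := hz2.trans (Nat.le_ceil zN)
      exact_mod_cast this
    have hsq : ∑ q ∈ Q, (1 : ℝ) / (q : ℝ) ^ 2 ≤ 1 / ((⌈zN⌉₊ : ℝ) - 1) :=
      (Finset.sum_le_sum_of_subset_of_nonneg hQsub fun q _ _ => by positivity).trans
        (sum_Ico_inv_sq_le hz'2)
    have hzc : 1 / ((⌈zN⌉₊ : ℝ) - 1) ≤ 1 / (zN - 1) :=
      one_div_le_one_div_of_le (by linarith) (by linarith [Nat.le_ceil zN])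
    have hinvsum : ∑ q ∈ Q, (1 : ℝ) / q ≤ Real.log ((1 / 3 : ℝ) / (1 / 10)) + 400 / L := by
      have h := sum_inv_primes_window_le hz3 hzy
      rw [hlogy, hlogz] at h
      have e1 : (1 / 3 * L) / (1 / 10 * L) = (1 / 3 : ℝ) / (1 / 10) := by field_simp
      have e2 : (40 : ℝ) / (1 / 10 * L) = 400 / L := by field_simp; ring
      rw [e1, e2] at h
      exact h
    -- pointwise: `(q-1)⁻¹ (F_q + |C|ℓ) ≤ F_q/q + 2A/q² + |C|ℓ · 2/q`
    have hpt : ∀ q ∈ Q, ((q : ℝ) - 1)⁻¹ *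
        (X * V * (upperSieveFun 1 (10 * θ₁ - 10 * (Real.log q / L)) + |C| * ℓ)) ≤
        X * V * (upperSieveFun 1 (10 * θ₁ - 10 * (Real.log q / L)) / q +
          2 * A * (1 / (q : ℝ) ^ 2) + 2 * (|C| * ℓ) * (1 / q)) := by
      intro q hq
      obtain ⟨hqp, hzq, hqy⟩ := hQmem q hq
      have hq2 : (2 : ℝ) ≤ q := by exact_mod_cast hqp.two_le
      have hq0 : (0 : ℝ) < q := by linarith
      set Fq := upperSieveFun 1 (10 * θ₁ - 10 * (Real.log q / L)) with hFq
      have hlogq : Real.log q < 1 / 3 * L := by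
        rw [← hlogy]; exact Real.log_lt_log hq0 hqy
      have hlogqz : 1 / 10 * L ≤ Real.log q := by
        rw [← hlogz]; exact Real.log_le_log (by linarith) hzq
      have hql : Real.log q / L < 1 / 3 := by rw [div_lt_iff₀ hL0]; linarith
      have hqL : 1 / 10 ≤ Real.log q / L := by rw [le_div_iff₀ hL0]; linarith
      have hs_mem : 10 * θ₁ - 10 * (Real.log q / L) ∈ Set.Icc (1 : ℝ) 4 :=
        ⟨by linarith, by linarith⟩
      have hFq0 : 0 ≤ Fq :=
        (upperSieveFun_one_pos ⟨by linarith [hs_mem.1], by linarith [hs_mem.2]⟩).le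
      have hFqA : Fq ≤ A := upperSieveFun_one_le hs_mem
      have hXV : 0 ≤ X * V := mul_nonneg hX0 hVI.1
      -- `(q-1)⁻¹ = 1/q + 1/(q(q-1))`, `1/(q(q-1)) ≤ 2/q²`, `(q-1)⁻¹ ≤ 2/q`
      have hinv1 : ((q : ℝ) - 1)⁻¹ ≤ 1 / q + 2 * (1 / (q : ℝ) ^ 2) := inv_sub_one_le_inv_add hq2
      have hinv2 : ((q : ℝ) - 1)⁻¹ ≤ 2 * (1 / q) := inv_sub_one_le_two_div hq2
      have hinv0 : 0 ≤ ((q : ℝ) - 1)⁻¹ := inv_nonneg.mpr (by linarith)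
      calc ((q : ℝ) - 1)⁻¹ * (X * V * (Fq + |C| * ℓ))
          = X * V * (((q : ℝ) - 1)⁻¹ * Fq + ((q : ℝ) - 1)⁻¹ * (|C| * ℓ)) := by ring
        _ ≤ X * V * ((1 / q + 2 * (1 / (q : ℝ) ^ 2)) * Fq + 2 * (1 / q) * (|C| * ℓ)) := by
            refine mul_le_mul_of_nonneg_left (add_le_add ?_ ?_) hXV
            · exact mul_le_mul_of_nonneg_right hinv1 hFq0
            · exact mul_le_mul_of_nonneg_right hinv2 (mul_nonneg (abs_nonneg C) hℓ0)
        _ = X * V * (Fq / q + 2 * (1 / (q : ℝ) ^ 2) * Fq + 2 * (|C| * ℓ) * (1 / q)) := by ring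
        _ ≤ X * V * (Fq / q + 2 * A * (1 / (q : ℝ) ^ 2) + 2 * (|C| * ℓ) * (1 / q)) := by
            refine mul_le_mul_of_nonneg_left ?_ hXV
            have : 2 * (1 / (q : ℝ) ^ 2) * Fq ≤ 2 * (1 / (q : ℝ) ^ 2) * A :=
              mul_le_mul_of_nonneg_left hFqA (by positivity)
            linarith
    have hXV0 : 0 ≤ X * V := mul_nonneg hX0 hVI.1
    have hw : (∑ q ∈ Q, upperSieveFun 1 (10 * θ₁ - 10 * (Real.log q / L)) / q) ≤
        b + ε' / 16 * 2 + (ε' / 16 + ε' / 16) := by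
      refine hwin.trans ?_
      have hI : (∫ β in (1 / 10 : ℝ)..(1 / 3), upperSieveFun 1 (10 * θ₁ - 10 * β) / β) ≤
          b + ε' / 16 * 2 := by
        have : ε' / 16 * Real.log ((1 / 3 : ℝ) / (1 / 10)) ≤ ε' / 16 * 2 :=
          mul_le_mul_of_nonneg_left hlog103 (by positivity)
        linarith [hint]
      have hK1 : A * (Real.log ((1 / 3 : ℝ) / (1 / 10)) / K) ≤ ε' / 16 := by
        have hKpos : (0 : ℝ) < K := by exact_mod_cast hK0
        calc A * (Real.log ((1 / 3 : ℝ) / (1 / 10)) / K) ≤ A * (2 / K) := by gcongr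
          _ = A * 2 / K := by ring
          _ ≤ ε' / 16 := hKε
      have hK2 : A * (40 * K / (1 / 10 * L)) ≤ ε' / 16 := h5
      have : A * (Real.log ((1 / 3 : ℝ) / (1 / 10)) / K + 40 * K / (1 / 10 * L)) ≤
          ε' / 16 + ε' / 16 := by rw [mul_add]; exact add_le_add hK1 hK2
      linarith
    have hsq' : 2 * A * ∑ q ∈ Q, (1 / (q : ℝ) ^ 2) ≤ ε' / 16 := by
      calc 2 * A * ∑ q ∈ Q, (1 / (q : ℝ) ^ 2) ≤ 2 * A * (1 / (zN - 1)) :=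
            mul_le_mul_of_nonneg_left (hsq.trans hzc) (by positivity)
        _ = 2 * A / (zN - 1) := by ring
        _ ≤ ε' / 16 := h6
    have hℓ' : 2 * (|C| * ℓ) * ∑ q ∈ Q, (1 : ℝ) / q ≤ ε' / 16 := by
      have h400 : (400 : ℝ) / L ≤ 1 := by
        rw [div_le_one hL0]; exact h400L
      calc 2 * (|C| * ℓ) * ∑ q ∈ Q, (1 : ℝ) / q ≤ 2 * (|C| * ℓ) * 3 := by
            refine mul_le_mul_of_nonneg_left ?_ (by positivity)
            linarith [hinvsum, hlog103]
        _ = 6 * |C| * ℓ := by ring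
        _ ≤ ε' / 16 := h2
    have t1 := mul_le_mul_of_nonneg_left hw hXV0
    have t2 : X * V * (2 * A * ∑ q ∈ Q, (1 / (q : ℝ) ^ 2)) ≤ X * V * (ε' / 16) :=
      mul_le_mul_of_nonneg_left hsq' hXV0
    have t3 : X * V * (2 * (|C| * ℓ) * ∑ q ∈ Q, (1 : ℝ) / q) ≤ X * V * (ε' / 16) :=
      mul_le_mul_of_nonneg_left hℓ' hXV0
    calc ∑ q ∈ Q, ((q : ℝ) - 1)⁻¹ *
          (X * V * (upperSieveFun 1 (10 * θ₁ - 10 * (Real.log q / L)) + |C| * ℓ))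
        ≤ ∑ q ∈ Q, X * V * (upperSieveFun 1 (10 * θ₁ - 10 * (Real.log q / L)) / q +
            2 * A * (1 / (q : ℝ) ^ 2) + 2 * (|C| * ℓ) * (1 / q)) := Finset.sum_le_sum hpt
      _ = X * V * (∑ q ∈ Q, upperSieveFun 1 (10 * θ₁ - 10 * (Real.log q / L)) / q) +
            X * V * (2 * A * ∑ q ∈ Q, (1 / (q : ℝ) ^ 2)) +
            X * V * (2 * (|C| * ℓ) * ∑ q ∈ Q, (1 : ℝ) / q) := by
          rw [Finset.mul_sum, Finset.mul_sum, Finset.mul_sum, Finset.mul_sum, Finset.mul_sum,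
            ← Finset.sum_add_distrib, ← Finset.sum_add_distrib]
          refine Finset.sum_congr rfl fun q _ => ?_
          ring
      _ ≤ X * V * (b + ε' / 16 * 2 + (ε' / 16 + ε' / 16)) + X * V * (ε' / 16) + X * V * (ε' / 16) :=
          add_le_add (add_le_add t1 t2) t3
      _ = X * V * (b + 3 * ε' / 8) := by ring
  -- (4) combine: `X ≤ (1 + η) N/L`
  have htotal : ∑ q ∈ Q, (siftedCountDvd N q zN : ℝ) ≤ X * V * (b + 3 * ε' / 8) + ε' / 8 * M := by
    calc ∑ q ∈ Q, (siftedCountDvd N q zN : ℝ)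
        ≤ ∑ q ∈ Q, (((q : ℝ) - 1)⁻¹ *
            (X * V * (upperSieveFun 1 (10 * θ₁ - 10 * (Real.log q / L)) + |C| * ℓ)) +
            ∑ d ∈ (Finset.range ⌈D / q⌉₊).filter (· ∣ primesProdBelow zN),
              |(chenGoldbachSeq N).remainder (q * d) N|) := Finset.sum_le_sum hq_bound
      _ ≤ X * V * (b + 3 * ε' / 8) + ε' / 8 * M := by
          rw [Finset.sum_add_distrib]; exact add_le_add hFsum hRsum
  have hXup : X ≤ (1 + η) * ((N : ℝ) / L) := hPNT.2
  have hmain : X * V * (b + 3 * ε' / 8) ≤ (b + ε' / 2) * M := by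
    have hbε : 0 ≤ b + 3 * ε' / 8 := by positivity
    have hηb : η * (b + 1) = ε' / 8 := by rw [hη]; field_simp
    have hηb' : η * b + η = ε' / 8 := by rw [← hηb]; ring
    have hη1 : η * (3 * ε' / 8) ≤ η := by
      have : 3 * ε' / 8 ≤ 1 := by linarith
      calc η * (3 * ε' / 8) ≤ η * 1 := mul_le_mul_of_nonneg_left this hη0.le
        _ = η := mul_one η
    calc X * V * (b + 3 * ε' / 8) ≤ (1 + η) * ((N : ℝ) / L) * V * (b + 3 * ε' / 8) :=
          mul_le_mul_of_nonneg_right (mul_le_mul_of_nonneg_right hXup hVI.1) hbε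
      _ = ((1 + η) * (b + 3 * ε' / 8)) * M := by rw [hM]; ring
      _ ≤ (b + ε' / 2) * M := by
          refine mul_le_mul_of_nonneg_right ?_ hMpos.le
          have e1 : (1 + η) * (b + 3 * ε' / 8) = b + 3 * ε' / 8 + η * b + η * (3 * ε' / 8) := by
            ring
          rw [e1]
          linarith
  show ∑ q ∈ Q, (siftedCountDvd N q zN : ℝ) ≤ (b + ε) * M
  have hfin : (b + ε' / 2) * M + ε' / 8 * M ≤ (b + ε) * M := by
    have e : (b + ε' / 2) * M + ε' / 8 * M = (b + 5 * ε' / 8) * M := by ring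
    rw [e]
    exact mul_le_mul_of_nonneg_right (by linarith) hMpos.le
  linarith

end Literature.NumberTheory.Sieve.Chen
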